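import Summits.QuantumFields.YangMills.Theorems.UnitScaleTiltProp7GaugeProjectorSupPackage
import Summits.QuantumFields.YangMills.Theorems.UnitScaleTiltProp7PcolPin
import HarnessLib

/-!
# Route `UnitScaleTilt`, crux K1 «MinimiserStabilityRegPr» (stmt-QuantumFields-19200), EX face row `norm_G`, N6 FILE C letters — **THE (c)-PACKAGE PINNED: THE FOUR `L^∞ → L^∞`
# LETTERS (c1) `‖R_S‖`, (c2) `‖G′ᴾR_S‖`, (c3) `‖DG′ᴾR_S‖`, (c4) `‖R_SG′ᴾ‖` (+ (c3′), + hPcol) WITH P3v's SOURCE LETTER DISCHARGED K-UNIFORMLY at ★p1's pinned coarse weight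
# `c₁ := c₀·(L³)^{K−n}`** — the (c)-package twin of PIN-A ✓`Prop7PcolPin.hPcol_pin` (width seat `ym3-torus-px5` gen 13; ★p1 g27 CHAIR WORD №28 «(c)-package»).

Cell `ym3-torus` (HUMAN RULING D-0037; rung R3 = SU(2) YM₃ on T³ — NOT d = 4, NOT infinite volume, NOT a mass gap, NOT Clay).  THEOREMS ONLY (0 `def`, 0 `sorry`, default heartbeats);
`--supports stmt-QuantumFields-19200 --as helper`; count-neutral.

WHAT.  ✓`Prop7GaugeProjectorSupPackage` gives the four letters CONDITIONAL on P4's source letter `hsrc` (constant `C_src`) and source form `hsrcid`.  §1 ★★★`hsrc_pin_exists` DISCHARGES both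
at once, K-uniformly: under `RegPr` (`10⁷L³ε₀ ≤ 1`), the LOD data at the pinned weight (`ι hι T hT`, mass `0 < am`, `G hAG hGA`), a top nested mean `Q″` (`hseq`) and the column VALUE letter
`hcol` (rate `κ`, constant `C_pt`), THERE IS a source map `c` (P3v's Gram-coefficient map, ✓`sub_projR_eq_G_lift_coeffSum`) with `(1 − projR)v = G_a(T(c v))` and
`‖(T c(v))(y)‖ ≤ C_src⋆(am, κ, C_pt)·Vb`, `C_src⋆ = 10·(18∕m_B(am)²)·(4(2(1+1∕μ′(am)))³)·(C_pt·(2(1+1∕κ))³)` — EXACTLY PIN-A's closed source constant (same window∕gap bookkeeping: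
✓`window_delta`∕`window_win`∕`gap_nonneg`∕`gap_le`∕`window_gap`, ✓`norm_lift_topMean_le`∕`norm_massive_inverse_le`∕`coarseGram_coercive`∕`coarseCoercivity_pos`, ✓`AT_mul_Cc_eq`, ✓`csrc_le_aux`,
✓`exp_nine_mul_le_three`).  §2 the four letters + (c3′) + hPcol at the pin, by `obtain ⟨c, hsrcid, hsrc⟩` and ONE `exact` each on the letters edition:
(c1) `(1 + B_v·C_src⋆)`, (c2) `B_v(1 + B_v·C_src⋆)`, (c3) `R₁(1 + B_v·C_src⋆)`, (c4) `B_v(1 + C_src⋆·B_v)`, (c3′) `R₁(1 + C_src⋆·B_v)`, hPcol `4√2·R₁(1 + C_src⋆·B_v)` (PIN-A's constant ∕ 5).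
WHAT IS PROVED (ns `Summit.QuantumFields.YangMills.Theorems.Prop7GaugeProjectorSupPackagePin`): ★★★`hsrc_pin_exists`; ★`norm_equiv_RS_le_pin` (c1), ★`norm_equiv_GprimeP_RS_le_pin` (c2),
★`norm_equiv_DL2_GprimeP_RS_le_pin` (c3), ★`norm_equiv_RS_GprimeP_le_pin` (c4), ★`gradient_row_pin` (c3′), ★★`hPcol_pin'` (hPcol's display, constant `4√2·(R₁·(1 + C_src⋆·B_v))`);
§3 the ROUTE-currency pins = ★p1 g27's FILE C letters at the pin: ★`norm_symm_GprimeP_RS_toL2S_le_pin` (`C₁ = √2·B_v(1 + B_v·C_src⋆)`), ★`norm_symm_DL2_GprimeP_RS_toL2S_le_pin`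
(`C₂ = √2·R₁(1 + B_v·C_src⋆)`), ★`norm_symm_RS_GprimeP_toL2S_le_pin` (`C₃ = √2·B_v(1 + C_src⋆·B_v)`).
DISPLAYED (all): `RegPr`, the LOD data at the pin with mass `0 < am`, `hseq`, the Lift letters `hRS hker` (where the operator needs them), `0 ≤ a′` (`G′ᴾ`'s own parameter), the column letter
`hcol` (`0 < κ`, `0 ≤ C_pt`) and the general-source letters `hGsup` (`B_v`) ∕ `hT1` (`R₁`) — the (L3′b) VALUE∕GRAD storey's outputs, closed member-free by ✓`Prop7PcolMember` §1 (`unitP1_pin`,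
`unitP3_pin`, `unitP2_pin`) at `am := 1`.
HYP-SAT (★★OWNER RULING №42): as PIN-A (letters inhabited K-free by V4∕V5b∕px12 g16; LOD∕Lift letters from ✓`exists_massive_inverse`∕✓`RS_eq_projR_of_lift`); conclusions are sup bounds of the
row's own objects; no `Prop` placeholder.
HONEST SCOPE.  Bookkeeping + real arithmetic over landed rows; CONDITIONAL on `hcol`, `hGsup`, `hT1`; nothing of N6's knit, `norm_G`, the EX rows, EX or the crux is proved here; the Yang–Mills
mass gap is NOT proved.

References: T. Bałaban, CMP **99** (1985) 389–434 [Balaban1985BackgroundPropagators] ((3.21)–(3.25) p.394, Thm 3.1 (3.42)∕(3.46) pp.397–398, (3.49) p.399, Thm 3.11 p.416); CMP **102** (1985) 277–309 [Balaban1985Variational] ((138)–(139) p.299); CMP **116** (1988) 1–22 [Balaban1988RG2Cluster] ((2.7) p.13).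
-/

set_option autoImplicit false

noncomputable section

open scoped BigOperators Matrix.Norms.L2Operator InnerProductSpace ComplexConjugate Matrix

namespace Summit.QuantumFields.YangMills.Theorems.Prop7GaugeProjectorSupPackagePin

open Literature.MathematicalPhysics.QuantumFieldTheory.Balaban1983to89
open Literature.MathematicalPhysics.QuantumFieldTheory.Balaban1983to89.T3ContinuumYM3Torus
open T4Continuum BlockAveraging
open BlockAveraging (Idx)
open B7Prop1Explicit (disp)
open B5Eq118OneStroke (iterBlockOf)
open B10Eq27TorusAxialLog (holT transl)
open B7TransferAnalyticMean (meanCLM)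
open B4Sect5Torus (TSite)
open B9SectCLatticeCarrier (Bond)
open B9Eq311L2Pairing (WL2)
open B11Eq103H1Complex (SiteL2K BondL2K projR)
open Summit.QuantumFields.YangMills.Theorems.Prop8Chart (emlIterU)
open T3SectALandauChart (eta eta_pos bgUnits)
open T3PrintedRegularMinimiser (RegPr)
open T3PrintedRegularOrbits (sites_eq)
open T3LevelShift (siteShift)
open Summit.QuantumFields.YangMills.Theorems.Prop7SectET3Transport (periodsT3 siteEquiv bondEquiv)
open Summit.QuantumFields.YangMills.Theorems.Prop7SectET3HilbertLetters (W₂ toL2 toL2S DL2 DstarL2 covLapSite)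
open Summit.QuantumFields.YangMills.Theorems.Prop7SectET3GaugeProjector (NS RS)
open Summit.QuantumFields.YangMills.Theorems.Prop7SectET3DeltaPiPInv (kerDProj GprimeP)
open Summit.QuantumFields.YangMills.Theorems.Prop7ComplementaryProjectorBlockDecay (norm_lift_topMean_le norm_massive_inverse_le coarseCoercivity_pos)
open Summit.QuantumFields.YangMills.Theorems.Prop7CoarseGramCoercivity (coarseGram_coercive)
open Summit.QuantumFields.YangMills.Theorems.Prop7LODSlotK2WindowLetters
open Summit.QuantumFields.YangMills.Theorems.Prop7KernelRow349Pin (exp_nine_mul_le_three)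
open Summit.QuantumFields.YangMills.Theorems.Prop7PcolOfGradientRow (hsrc_of_P3v)
open Summit.QuantumFields.YangMills.Theorems.Prop7ComplementaryProjectorSourceForm (sub_projR_eq_G_lift_coeffSum)
open Summit.QuantumFields.YangMills.Theorems.Prop7PcolPin (AT_mul_Cc_eq csrc_le_aux)
open Summit.QuantumFields.YangMills.Theorems.Prop7GaugeProjectorSupPackage (norm_equiv_RS_le_of_letters norm_equiv_GprimeP_RS_le_of_letters norm_equiv_DL2_GprimeP_RS_le_of_letters
  norm_equiv_RS_GprimeP_le_of_letters gradient_row_of_letters' hPcol_of_letters'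
  norm_symm_GprimeP_RS_toL2S_le_of_letters norm_symm_DL2_GprimeP_RS_toL2S_le_of_letters norm_symm_RS_GprimeP_toL2S_le_of_letters)

variable (F : T3Family) {n K : ℕ} (h : n ≤ K) {c₀ cB : ℝ} [Fact (0 < c₀)] [Fact (0 < cB)]
  {ε₀ : ℝ} (hε₀ : 0 < ε₀) (hε7 : 10 ^ 7 * (F.L : ℝ) ^ 3 * ε₀ ≤ 1)
  (U₀ : GaugeField (F.P K) 0 (Matrix.specialUnitaryGroup (Fin 2) ℂ)) (hreg : RegPr F n K ε₀ U₀)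
  (Q'' : SiteL2K ℂ 3 (periodsT3 F K) c₀ W₂ →ₗ[ℂ] (Site (F.P K) (K - n) → Matrix (Fin 2) (Fin 2) ℂ))
  (hseq : ∀ lam : Site (F.P K) 0 → Matrix (Fin 2) (Fin 2) ℂ, ∃ ns : (j : ℕ) → Site (F.P K) j → Matrix (Fin 2) (Fin 2) ℂ, ns 0 = lam ∧
      (∀ (j : ℕ) (y : Site (F.P K) (j + 1)), ns (j + 1) y = ns j (emb y) - meanCLM (Idx (F.P K)) (Matrix (Fin 2) (Fin 2) ℂ) fun i : Idx (F.P K) =>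
        ns j (emb y) - ((holT (emlIterU j (bgUnits F K U₀)) (emb y) (stairWord i.2.1 (off i.1)) : (Matrix (Fin 2) (Fin 2) ℂ)ˣ) : Matrix (Fin 2) (Fin 2) ℂ) *
          ns j (transl (emb y) (disp (stairWord i.2.1 (off i.1)))) * (((holT (emlIterU j (bgUnits F K U₀)) (emb y) (stairWord i.2.1 (off i.1)))⁻¹ : (Matrix (Fin 2) (Fin 2) ℂ)ˣ) : Matrix (Fin 2) (Fin 2) ℂ)) ∧
      ns (K - n) = Q'' (toL2S F K c₀ lam))
  (hRS : RS F n K h c₀ cB U₀ = projR (covLapSite F n K c₀ U₀) Q'')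
  (hker : LinearMap.ker Q'' ≤ NS F n K h c₀ cB U₀)

/-! ## §1 ★★★ The source letter pinned -/

include hε₀ hε7 hreg hseq in
/-- ★★★ **P3v's SOURCE LETTER AND SOURCE FORM, DISCHARGED K-UNIFORMLY AT THE PIN `c₁ := c₀·(L³)^{K−n}`**: there is a source map `c` with `(1 − projR)v = G_a(T(c v))` for all `v` and
`‖(T c(v))(y)‖ ≤ C_src⋆·Vb` whenever `‖v(y)‖ ≤ Vb` for all `y`, `C_src⋆ = 10·(18∕m_B(am)²)·(4(2(1+1∕μ′(am)))³)·(C_pt·(2(1+1∕κ))³)` (PIN-A's closed source constant).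
[cite: Balaban1985BackgroundPropagators, (3.21)–(3.25) p.394, Thm 3.1 (3.42)∕(3.46) pp.397–398, (3.49) p.399; Balaban1985Variational, (138)–(139) p.299] -/
theorem hsrc_pin_exists (hnK : n < K) {am : ℝ} (ham : 0 < am) [hc₁ : Fact (0 < (c₀ * ((F.L : ℝ) ^ 3) ^ (K - n)))]
    (ι : (Site (F.P K) (K - n) → Matrix (Fin 2) (Fin 2) ℂ) →ₗ[ℂ] SiteL2K ℂ 3 (periodsT3 F n) (c₀ * ((F.L : ℝ) ^ 3) ^ (K - n)) W₂)
    (hι : ∀ c, ι c = toL2S F n (c₀ * ((F.L : ℝ) ^ 3) ^ (K - n)) (fun z => c (siteShift (sites_eq F n K h) z)))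
    (T : SiteL2K ℂ 3 (periodsT3 F n) (c₀ * ((F.L : ℝ) ^ 3) ^ (K - n)) W₂ →ₗ[ℂ] SiteL2K ℂ 3 (periodsT3 F K) c₀ W₂)
    (hT : ∀ (l : SiteL2K ℂ 3 (periodsT3 F K) c₀ W₂) (f : SiteL2K ℂ 3 (periodsT3 F n) (c₀ * ((F.L : ℝ) ^ 3) ^ (K - n)) W₂), ⟪ι (Q'' l), f⟫_ℂ = ⟪l, T f⟫_ℂ)
    (G : SiteL2K ℂ 3 (periodsT3 F K) c₀ W₂ →ₗ[ℂ] SiteL2K ℂ 3 (periodsT3 F K) c₀ W₂)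
    (hAG : ∀ f, covLapSite F n K c₀ U₀ (G f) + (am : ℂ) • T (ι (Q'' (G f))) = f)
    (hGA : ∀ u, G (covLapSite F n K c₀ U₀ u + (am : ℂ) • T (ι (Q'' u))) = u)
    {κ Cpt : ℝ} (hκ : 0 < κ) (hCpt : 0 ≤ Cpt)
    (hcol : ∀ (y : Site (F.P K) (K - n)) (Y : Matrix (Fin 2) (Fin 2) ℂ) (x : Site (F.P K) 0),
      ‖WL2.equiv ℂ _ W₂ (G (T (ι (Pi.single y Y)))) (siteEquiv F K x)‖ ≤ Cpt * Real.exp (-(κ * (Site.tdist (P := F.P K) (iterBlockOf (K - n) x) y : ℝ))) * ‖Y‖) :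
    ∃ c : SiteL2K ℂ 3 (periodsT3 F K) c₀ W₂ → SiteL2K ℂ 3 (periodsT3 F n) (c₀ * ((F.L : ℝ) ^ 3) ^ (K - n)) W₂,
      (∀ v, v - projR (covLapSite F n K c₀ U₀) Q'' v = G (T (c v))) ∧
      ∀ (v : SiteL2K ℂ 3 (periodsT3 F K) c₀ W₂) (Vb : ℝ), (∀ y, ‖WL2.equiv ℂ _ W₂ v y‖ ≤ Vb) → ∀ y, ‖WL2.equiv ℂ _ W₂ (T (c v)) y‖ ≤ (10 * (18 / (2 / ((1 + 25 / 8) * (600 * (27 / 4 : ℝ) ^ 6 + am))) ^ 2) * (4 * (2 * (1 + 1 / (min ((1 / (10 * Real.sqrt (max 2 (16 / am)) * Real.sqrt (27 + 2025 / 8 * am))) / 2) ((2 / ((1 + 25 / 8) * (600 * (27 / 4 : ℝ) ^ 6 + am))) / (3 * (Real.sqrt (max 2 (16 / am)) * (2 + Real.sqrt (max 2 (16 / am))) * (3 * Real.sqrt 3 + 27 + 9 * Real.sqrt am * Real.sqrt (25 / 8) + 81 * am * (25 / 8))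
                * (8 * Real.sqrt (max 2 (16 / am)) + 8 * Real.sqrt (max 2 (16 / am)) ^ 2) * (10 * Real.sqrt (25 / 8)) + 9 * (max 2 (16 / am)) * Real.sqrt (25 / 8))))))) ^ 3) * (Cpt * (2 * (1 + 1 / κ)) ^ 3)) * Vb := by
  have hc₀ : 0 < c₀ := Fact.out
  have hc₁ : 0 < c₀ * ((F.L : ℝ) ^ 3) ^ (K - n) := hc₁.out
  have hL1 : (1 : ℝ) < F.L := by exact_mod_cast F.hL.2
  have hL0 : (0 : ℝ) < F.L := by linarith
  have hLP := (F.P K).L_pos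
  -- ★p1's pin `c₁ := c₀(L³)^(K−n)`: the raw letters are K-free numbers
  have hsx : (25 / 8) * (c₀ * ((F.L : ℝ) ^ 3) ^ (K - n) * ((((F.P K).L : ℝ) ^ (F.P K).d) ^ (K - n))⁻¹ / c₀) = 25 / 8 := by
    rw [show ((F.P K).L : ℝ) = (F.L : ℝ) from rfl, T3Family.P_d]; field_simp
  have hMraw : 16 * c₀ * ((F.L : ℝ) ^ (K - n)) ^ 3 / (am * (c₀ * ((F.L : ℝ) ^ 3) ^ (K - n))) = 16 / am := by
    rw [← pow_mul, ← pow_mul, Nat.mul_comm]; field_simp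
  have hM : max 2 (16 * c₀ * ((F.L : ℝ) ^ (K - n)) ^ 3 / (am * (c₀ * ((F.L : ℝ) ^ 3) ^ (K - n)))) = max 2 (16 / am) := by rw [hMraw]
  have hdEx : 600 * (27 / 4 : ℝ) ^ 6 * (c₀ * ((F.L : ℝ) ^ 3) ^ (K - n) / (c₀ * ((F.L : ℝ) ^ 3) ^ (K - n))) = 600 * (27 / 4 : ℝ) ^ 6 := by
    rw [div_self (by positivity), mul_one]
  have hη : 0 < eta F n K := eta_pos F n K
  have hη1 : eta F n K ≤ 1 := by
    show ((F.L : ℝ)⁻¹) ^ (K - n) ≤ 1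
    exact pow_le_one₀ (inv_nonneg.2 hL0.le) (inv_le_one_of_one_le₀ hL1.le)
  -- the closed letters of the massive mass `am`
  set M' : ℝ := max 2 (16 / am) with hM'def
  have hM'2 : 2 ≤ M' := le_max_left _ _
  set cδ : ℝ := 27 + 2025 / 8 * am with hcδdef
  have hcδ1 : 1 ≤ cδ := by rw [hcδdef]; linarith [ham.le]
  set μ : ℝ := 1 / (10 * Real.sqrt M' * Real.sqrt cδ) with hμdef
  have hsM1 : 1 ≤ Real.sqrt M' := Real.one_le_sqrt.2 (by linarith)
  have hsc1 : 1 ≤ Real.sqrt cδ := Real.one_le_sqrt.2 hcδ1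
  have hμ0 : 0 < μ := by rw [hμdef]; positivity
  have hμ10 : 10 * μ ≤ 1 := by
    rw [hμdef]
    have h1 : (1 : ℝ) ≤ Real.sqrt M' * Real.sqrt cδ := one_le_mul_of_one_le_of_one_le hsM1 hsc1
    rw [show 10 * (1 / (10 * Real.sqrt M' * Real.sqrt cδ)) = 1 / (Real.sqrt M' * Real.sqrt cδ) by field_simp]
    rw [div_le_one (by positivity)]
    exact h1
  set Γ : ℝ := (Real.sqrt (max 2 (16 / am)) * (2 + Real.sqrt (max 2 (16 / am))) * (3 * Real.sqrt 3 + 27 + 9 * Real.sqrt am * Real.sqrt (25 / 8) + 81 * am * (25 / 8))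
                * (8 * Real.sqrt (max 2 (16 / am)) + 8 * Real.sqrt (max 2 (16 / am)) ^ 2) * (10 * Real.sqrt (25 / 8)) + 9 * (max 2 (16 / am)) * Real.sqrt (25 / 8)) with hΓdef
  have hΓ : 0 < Γ := by rw [hΓdef]; positivity
  set mBc : ℝ := (2 / ((1 + 25 / 8) * (600 * (27 / 4 : ℝ) ^ 6 + am))) with hmBcdef
  have hmBc : 0 < mBc := by rw [hmBcdef]; positivity
  set μ' : ℝ := min (μ / 2) (mBc / (3 * Γ)) with hμ'def
  have hμ'0 : 0 < μ' := lt_min (by linarith) (by positivity)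
  have hμ'le : μ' ≤ μ / 2 := min_le_left _ _
  have hμ'lt : μ' < μ := by linarith
  have hμ'3 : 3 * μ' ≤ 1 := by linarith
  have hμ'9 : 9 * μ' ≤ 1 := by linarith
  have hμ'Γ' : μ' ≤ mBc / (3 * Γ) := min_le_right _ _
  -- the window rows at the raw letters (routeR-w4 g27's W1), at slope `μ′`
  have hδ := window_delta (a := am) (sx := ((25 / 8) * (c₀ * ((F.L : ℝ) ^ 3) ^ (K - n) * ((((F.P K).L : ℝ) ^ (F.P K).d) ^ (K - n))⁻¹ / c₀))) (η := eta F n K) ham hsx hη hη1 hμ'0.le hμ'3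
  have hwinμ := window_win ham hM
  have hwin : Real.sqrt (max 2 (16 * c₀ * ((F.L : ℝ) ^ (K - n)) ^ 3 / (am * (c₀ * ((F.L : ℝ) ^ 3) ^ (K - n))))) * (Real.sqrt cδ * μ') ≤ 1 / 10 := by
    refine le_trans ?_ hwinμ
    apply mul_le_mul_of_nonneg_left _ (Real.sqrt_nonneg _)
    exact mul_le_mul_of_nonneg_left hμ'lt.le (Real.sqrt_nonneg _)
  have hG0 := gap_nonneg (a := am) (sx := ((25 / 8) * (c₀ * ((F.L : ℝ) ^ 3) ^ (K - n) * ((((F.P K).L : ℝ) ^ (F.P K).d) ^ (K - n))⁻¹ / c₀))) (η := eta F n K)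
    (M := max 2 (16 * c₀ * ((F.L : ℝ) ^ (K - n)) ^ 3 / (am * (c₀ * ((F.L : ℝ) ^ 3) ^ (K - n))))) (μ' := μ') ham hη (by positivity) hμ'0.le
  have hGle := gap_le (a := am) (sx := ((25 / 8) * (c₀ * ((F.L : ℝ) ^ 3) ^ (K - n) * ((((F.P K).L : ℝ) ^ (F.P K).d) ^ (K - n))⁻¹ / c₀))) (η := eta F n K)
    (M := max 2 (16 * c₀ * ((F.L : ℝ) ^ (K - n)) ^ 3 / (am * (c₀ * ((F.L : ℝ) ^ 3) ^ (K - n))))) (μ' := μ') ham hsx hη hη1 hM hμ'0.le hμ'3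
  have hmBraw : (2 / ((1 + ((25 / 8) * (c₀ * ((F.L : ℝ) ^ 3) ^ (K - n) * ((((F.P K).L : ℝ) ^ (F.P K).d) ^ (K - n))⁻¹ / c₀))) * ((600 * (27 / 4 : ℝ) ^ 6 * (c₀ * ((F.L : ℝ) ^ 3) ^ (K - n) / (c₀ * ((F.L : ℝ) ^ 3) ^ (K - n)))) + am))) = mBc := by
    rw [hsx, hdEx]
  have hμ'Γ : μ' ≤ (2 / ((1 + ((25 / 8) * (c₀ * ((F.L : ℝ) ^ 3) ^ (K - n) * ((((F.P K).L : ℝ) ^ (F.P K).d) ^ (K - n))⁻¹ / c₀))) * ((600 * (27 / 4 : ℝ) ^ 6 * (c₀ * ((F.L : ℝ) ^ 3) ^ (K - n) / (c₀ * ((F.L : ℝ) ^ 3) ^ (K - n)))) + am))) / (3 * Γ) := by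
    rw [hmBraw]; exact hμ'Γ'
  obtain ⟨hgap, hP2pos, hP2⟩ := window_gap hG0 hGle hΓ (by rw [hmBraw]; exact hmBc) hμ'Γ
  -- the three operator letters at `RegPr` (routeR-w2's B6 dischargers)
  have hCTb := norm_lift_topMean_le F h hε₀ hε7 U₀ hreg Q'' hseq ι hι
  have hGn := norm_massive_inverse_le F h hε₀ hε7 U₀ hreg Q'' hseq ι hι T hT ham G hAG
  have hcoer := coarseGram_coercive F hnK h hε₀ hε7 U₀ hreg Q'' hseq ι hι T hT ham G hAG
  have hmB := coarseCoercivity_pos F (n := n) (K := K) (c₀ := c₀) (c₁ := c₀ * ((F.L : ℝ) ^ 3) ^ (K - n)) ham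
  refine ⟨_, sub_projR_eq_G_lift_coeffSum F h U₀ Q'' ι hι T hT G hAG hGA hmB hcoer, fun v Vb hv y => ?_⟩
  have hVb : 0 ≤ Vb := (norm_nonneg _).trans (hv y)
  have h5 := hsrc_of_P3v F h hε₀ hε7 U₀ hreg Q'' hseq ι hι T hT ham G hAG hμ'0 (δ₁ := Real.sqrt cδ * μ') (by positivity) hδ hwin
    (Real.sqrt_nonneg _) hCTb (by positivity) hGn hmB hcoer hgap hCpt hκ hcol v Vb hv y
  have hexp9 : Real.exp (9 * μ') ≤ 3 := exp_nine_mul_le_three hμ'9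
  have hI0 := (inv_pos.2 hP2pos).le
  have hAT : 0 ≤ (5 / 4) * Real.sqrt (2 * (c₀ * ((F.L : ℝ) ^ 3) ^ (K - n))) * ((((F.P K).L : ℝ) ^ (F.P K).d) ^ (K - n))⁻¹ / c₀ * (Real.sqrt (2 * (c₀ * ((F.L : ℝ) ^ 3) ^ (K - n))) * (Real.sqrt (c₀ * ((F.L : ℝ) ^ 3) ^ (K - n)))⁻¹) := by positivity
  have hF4 : 0 ≤ 4 * (2 * (1 + 1 / μ')) ^ 3 := by positivity
  have hCc : 0 ≤ c₀ * (Real.sqrt (c₀ * ((F.L : ℝ) ^ 3) ^ (K - n)))⁻¹ * Cpt * (((((F.P K).L : ℝ) ^ (F.P K).d) ^ (K - n)) * (2 * (1 + 1 / κ)) ^ 3) := by positivity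
  have hcs := csrc_le_aux hAT hI0 hP2 (Real.exp_pos _).le hexp9 hF4 hCc
  have hid := AT_mul_Cc_eq (C := Cpt) (B := (2 * (1 + 1 / κ)) ^ 3) hc₀ hc₁ (by positivity : (0:ℝ) < (((F.P K).L : ℝ) ^ (F.P K).d) ^ (K - n))
  refine h5.trans (mul_le_mul_of_nonneg_right (hcs.trans (le_of_eq ?_)) hVb)
  rw [hmBraw]
  calc 4 * ((5 / 4) * Real.sqrt (2 * (c₀ * ((F.L : ℝ) ^ 3) ^ (K - n))) * ((((F.P K).L : ℝ) ^ (F.P K).d) ^ (K - n))⁻¹ / c₀ * (Real.sqrt (2 * (c₀ * ((F.L : ℝ) ^ 3) ^ (K - n))) * (Real.sqrt (c₀ * ((F.L : ℝ) ^ 3) ^ (K - n)))⁻¹))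
        * (6 / mBc ^ 2 * 3 * (4 * (2 * (1 + 1 / μ')) ^ 3) * (c₀ * (Real.sqrt (c₀ * ((F.L : ℝ) ^ 3) ^ (K - n)))⁻¹ * Cpt * (((((F.P K).L : ℝ) ^ (F.P K).d) ^ (K - n)) * (2 * (1 + 1 / κ)) ^ 3)))
      = 4 * (6 / mBc ^ 2 * 3 * (4 * (2 * (1 + 1 / μ')) ^ 3)) * ((5 / 4) * Real.sqrt (2 * (c₀ * ((F.L : ℝ) ^ 3) ^ (K - n))) * ((((F.P K).L : ℝ) ^ (F.P K).d) ^ (K - n))⁻¹ / c₀ * (Real.sqrt (2 * (c₀ * ((F.L : ℝ) ^ 3) ^ (K - n))) * (Real.sqrt (c₀ * ((F.L : ℝ) ^ 3) ^ (K - n)))⁻¹)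
          * (c₀ * (Real.sqrt (c₀ * ((F.L : ℝ) ^ 3) ^ (K - n)))⁻¹ * Cpt * (((((F.P K).L : ℝ) ^ (F.P K).d) ^ (K - n)) * (2 * (1 + 1 / κ)) ^ 3))) := by ring
    _ = 4 * (6 / mBc ^ 2 * 3 * (4 * (2 * (1 + 1 / μ')) ^ 3)) * ((5 / 2) * Cpt * (2 * (1 + 1 / κ)) ^ 3) := by rw [hid]
    _ = (10 * (18 / (2 / ((1 + 25 / 8) * (600 * (27 / 4 : ℝ) ^ 6 + am))) ^ 2) * (4 * (2 * (1 + 1 / (min ((1 / (10 * Real.sqrt (max 2 (16 / am)) * Real.sqrt (27 + 2025 / 8 * am))) / 2) ((2 / ((1 + 25 / 8) * (600 * (27 / 4 : ℝ) ^ 6 + am))) / (3 * (Real.sqrt (max 2 (16 / am)) * (2 + Real.sqrt (max 2 (16 / am))) * (3 * Real.sqrt 3 + 27 + 9 * Real.sqrt am * Real.sqrt (25 / 8) + 81 * am * (25 / 8))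
                * (8 * Real.sqrt (max 2 (16 / am)) + 8 * Real.sqrt (max 2 (16 / am)) ^ 2) * (10 * Real.sqrt (25 / 8)) + 9 * (max 2 (16 / am)) * Real.sqrt (25 / 8))))))) ^ 3) * (Cpt * (2 * (1 + 1 / κ)) ^ 3)) := by rw [hmBcdef, hμ'def, hμdef, hM'def, hcδdef, hΓdef]; ring

/-! ## §2 The (c)-package at the pin -/

include hε₀ hε7 hreg hseq hRS in
omit [Fact (0 < cB)] in
/-- ★ **(c1) PINNED: `‖(R_S g)(y)‖ ≤ (1 + B_v·C_src⋆)·Gb`.** [cite: Balaban1985BackgroundPropagators, (3.21)–(3.25) p.394, Thm 3.1 (3.42)∕(3.46) pp.397–398, (3.49) p.399; Balaban1985Variational, (138)–(139) p.299] -/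
theorem norm_equiv_RS_le_pin (hnK : n < K) {am : ℝ} (ham : 0 < am) [hc₁ : Fact (0 < (c₀ * ((F.L : ℝ) ^ 3) ^ (K - n)))]
    (ι : (Site (F.P K) (K - n) → Matrix (Fin 2) (Fin 2) ℂ) →ₗ[ℂ] SiteL2K ℂ 3 (periodsT3 F n) (c₀ * ((F.L : ℝ) ^ 3) ^ (K - n)) W₂)
    (hι : ∀ c, ι c = toL2S F n (c₀ * ((F.L : ℝ) ^ 3) ^ (K - n)) (fun z => c (siteShift (sites_eq F n K h) z)))
    (T : SiteL2K ℂ 3 (periodsT3 F n) (c₀ * ((F.L : ℝ) ^ 3) ^ (K - n)) W₂ →ₗ[ℂ] SiteL2K ℂ 3 (periodsT3 F K) c₀ W₂)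
    (hT : ∀ (l : SiteL2K ℂ 3 (periodsT3 F K) c₀ W₂) (f : SiteL2K ℂ 3 (periodsT3 F n) (c₀ * ((F.L : ℝ) ^ 3) ^ (K - n)) W₂), ⟪ι (Q'' l), f⟫_ℂ = ⟪l, T f⟫_ℂ)
    (G : SiteL2K ℂ 3 (periodsT3 F K) c₀ W₂ →ₗ[ℂ] SiteL2K ℂ 3 (periodsT3 F K) c₀ W₂)
    (hAG : ∀ f, covLapSite F n K c₀ U₀ (G f) + (am : ℂ) • T (ι (Q'' (G f))) = f)
    (hGA : ∀ u, G (covLapSite F n K c₀ U₀ u + (am : ℂ) • T (ι (Q'' u))) = u)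
    {κ Cpt : ℝ} (hκ : 0 < κ) (hCpt : 0 ≤ Cpt)
    (hcol : ∀ (y : Site (F.P K) (K - n)) (Y : Matrix (Fin 2) (Fin 2) ℂ) (x : Site (F.P K) 0),
      ‖WL2.equiv ℂ _ W₂ (G (T (ι (Pi.single y Y)))) (siteEquiv F K x)‖ ≤ Cpt * Real.exp (-(κ * (Site.tdist (P := F.P K) (iterBlockOf (K - n) x) y : ℝ))) * ‖Y‖)
    {Bv : ℝ} (hGsup : ∀ (f : SiteL2K ℂ 3 (periodsT3 F K) c₀ W₂) (Fb : ℝ), (∀ y, ‖WL2.equiv ℂ _ W₂ f y‖ ≤ Fb) → ∀ y, ‖WL2.equiv ℂ _ W₂ (G f) y‖ ≤ Bv * Fb)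
    (g : SiteL2K ℂ 3 (periodsT3 F K) c₀ W₂) (Gb : ℝ) (hg : ∀ y, ‖WL2.equiv ℂ _ W₂ g y‖ ≤ Gb) (y : TSite 3 (periodsT3 F K)) :
    ‖WL2.equiv ℂ _ W₂ (RS F n K h c₀ cB U₀ g) y‖ ≤ (1 + Bv * (10 * (18 / (2 / ((1 + 25 / 8) * (600 * (27 / 4 : ℝ) ^ 6 + am))) ^ 2) * (4 * (2 * (1 + 1 / (min ((1 / (10 * Real.sqrt (max 2 (16 / am)) * Real.sqrt (27 + 2025 / 8 * am))) / 2) ((2 / ((1 + 25 / 8) * (600 * (27 / 4 : ℝ) ^ 6 + am))) / (3 * (Real.sqrt (max 2 (16 / am)) * (2 + Real.sqrt (max 2 (16 / am))) * (3 * Real.sqrt 3 + 27 + 9 * Real.sqrt am * Real.sqrt (25 / 8) + 81 * am * (25 / 8))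
                * (8 * Real.sqrt (max 2 (16 / am)) + 8 * Real.sqrt (max 2 (16 / am)) ^ 2) * (10 * Real.sqrt (25 / 8)) + 9 * (max 2 (16 / am)) * Real.sqrt (25 / 8))))))) ^ 3) * (Cpt * (2 * (1 + 1 / κ)) ^ 3))) * Gb := by
  obtain ⟨c, hsrcid, hsrc⟩ := hsrc_pin_exists F h hε₀ hε7 U₀ hreg Q'' hseq hnK ham ι hι T hT G hAG hGA hκ hCpt hcol
  exact norm_equiv_RS_le_of_letters F h U₀ Q'' T G hRS c hsrcid hsrc hGsup g Gb hg y

include hε₀ hε7 hreg hseq hRS hker in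
/-- ★ **(c2) PINNED: `‖(G′ᴾ_{a′}(R_S g))(y)‖ ≤ B_v·(1 + B_v·C_src⋆)·Gb`** ((Z0): `G′ᴾR_S = G_aR_S`). [cite: Balaban1985BackgroundPropagators, (3.21)–(3.25) p.394, Thm 3.1 (3.42)∕(3.46) pp.397–398, (3.49) p.399; Balaban1985Variational, (138)–(139) p.299] -/
theorem norm_equiv_GprimeP_RS_le_pin (hnK : n < K) {am : ℝ} (ham : 0 < am) [hc₁ : Fact (0 < (c₀ * ((F.L : ℝ) ^ 3) ^ (K - n)))]
    (ι : (Site (F.P K) (K - n) → Matrix (Fin 2) (Fin 2) ℂ) →ₗ[ℂ] SiteL2K ℂ 3 (periodsT3 F n) (c₀ * ((F.L : ℝ) ^ 3) ^ (K - n)) W₂)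
    (hι : ∀ c, ι c = toL2S F n (c₀ * ((F.L : ℝ) ^ 3) ^ (K - n)) (fun z => c (siteShift (sites_eq F n K h) z)))
    (T : SiteL2K ℂ 3 (periodsT3 F n) (c₀ * ((F.L : ℝ) ^ 3) ^ (K - n)) W₂ →ₗ[ℂ] SiteL2K ℂ 3 (periodsT3 F K) c₀ W₂)
    (hT : ∀ (l : SiteL2K ℂ 3 (periodsT3 F K) c₀ W₂) (f : SiteL2K ℂ 3 (periodsT3 F n) (c₀ * ((F.L : ℝ) ^ 3) ^ (K - n)) W₂), ⟪ι (Q'' l), f⟫_ℂ = ⟪l, T f⟫_ℂ)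
    (G : SiteL2K ℂ 3 (periodsT3 F K) c₀ W₂ →ₗ[ℂ] SiteL2K ℂ 3 (periodsT3 F K) c₀ W₂)
    (hAG : ∀ f, covLapSite F n K c₀ U₀ (G f) + (am : ℂ) • T (ι (Q'' (G f))) = f)
    (hGA : ∀ u, G (covLapSite F n K c₀ U₀ u + (am : ℂ) • T (ι (Q'' u))) = u)
    {a' : ℝ} (ha' : 0 ≤ a')
    {κ Cpt : ℝ} (hκ : 0 < κ) (hCpt : 0 ≤ Cpt)
    (hcol : ∀ (y : Site (F.P K) (K - n)) (Y : Matrix (Fin 2) (Fin 2) ℂ) (x : Site (F.P K) 0),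
      ‖WL2.equiv ℂ _ W₂ (G (T (ι (Pi.single y Y)))) (siteEquiv F K x)‖ ≤ Cpt * Real.exp (-(κ * (Site.tdist (P := F.P K) (iterBlockOf (K - n) x) y : ℝ))) * ‖Y‖)
    {Bv : ℝ} (hGsup : ∀ (f : SiteL2K ℂ 3 (periodsT3 F K) c₀ W₂) (Fb : ℝ), (∀ y, ‖WL2.equiv ℂ _ W₂ f y‖ ≤ Fb) → ∀ y, ‖WL2.equiv ℂ _ W₂ (G f) y‖ ≤ Bv * Fb)
    (g : SiteL2K ℂ 3 (periodsT3 F K) c₀ W₂) (Gb : ℝ) (hg : ∀ y, ‖WL2.equiv ℂ _ W₂ g y‖ ≤ Gb) (y : TSite 3 (periodsT3 F K)) :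
    ‖WL2.equiv ℂ _ W₂ (GprimeP F n K h c₀ cB a' U₀ (RS F n K h c₀ cB U₀ g)) y‖ ≤ Bv * (1 + Bv * (10 * (18 / (2 / ((1 + 25 / 8) * (600 * (27 / 4 : ℝ) ^ 6 + am))) ^ 2) * (4 * (2 * (1 + 1 / (min ((1 / (10 * Real.sqrt (max 2 (16 / am)) * Real.sqrt (27 + 2025 / 8 * am))) / 2) ((2 / ((1 + 25 / 8) * (600 * (27 / 4 : ℝ) ^ 6 + am))) / (3 * (Real.sqrt (max 2 (16 / am)) * (2 + Real.sqrt (max 2 (16 / am))) * (3 * Real.sqrt 3 + 27 + 9 * Real.sqrt am * Real.sqrt (25 / 8) + 81 * am * (25 / 8))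
                * (8 * Real.sqrt (max 2 (16 / am)) + 8 * Real.sqrt (max 2 (16 / am)) ^ 2) * (10 * Real.sqrt (25 / 8)) + 9 * (max 2 (16 / am)) * Real.sqrt (25 / 8))))))) ^ 3) * (Cpt * (2 * (1 + 1 / κ)) ^ 3))) * Gb := by
  obtain ⟨c, hsrcid, hsrc⟩ := hsrc_pin_exists F h hε₀ hε7 U₀ hreg Q'' hseq hnK ham ι hι T hT G hAG hGA hκ hCpt hcol
  exact norm_equiv_GprimeP_RS_le_of_letters F h U₀ Q'' hseq ι T G hGA hRS hker ha' c hsrcid hsrc hGsup g Gb hg y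

include hε₀ hε7 hreg hseq hRS hker in
/-- ★ **(c3) PINNED: `‖(D_{U₀}G′ᴾ_{a′}(R_S g))(p)‖ ≤ R₁·(1 + B_v·C_src⋆)·Gb`** ((Z0) + T1). [cite: Balaban1985BackgroundPropagators, (3.21)–(3.25) p.394, Thm 3.1 (3.42)∕(3.46) pp.397–398, (3.49) p.399; Balaban1985Variational, (138)–(139) p.299] -/
theorem norm_equiv_DL2_GprimeP_RS_le_pin (hnK : n < K) {am : ℝ} (ham : 0 < am) [hc₁ : Fact (0 < (c₀ * ((F.L : ℝ) ^ 3) ^ (K - n)))]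
    (ι : (Site (F.P K) (K - n) → Matrix (Fin 2) (Fin 2) ℂ) →ₗ[ℂ] SiteL2K ℂ 3 (periodsT3 F n) (c₀ * ((F.L : ℝ) ^ 3) ^ (K - n)) W₂)
    (hι : ∀ c, ι c = toL2S F n (c₀ * ((F.L : ℝ) ^ 3) ^ (K - n)) (fun z => c (siteShift (sites_eq F n K h) z)))
    (T : SiteL2K ℂ 3 (periodsT3 F n) (c₀ * ((F.L : ℝ) ^ 3) ^ (K - n)) W₂ →ₗ[ℂ] SiteL2K ℂ 3 (periodsT3 F K) c₀ W₂)
    (hT : ∀ (l : SiteL2K ℂ 3 (periodsT3 F K) c₀ W₂) (f : SiteL2K ℂ 3 (periodsT3 F n) (c₀ * ((F.L : ℝ) ^ 3) ^ (K - n)) W₂), ⟪ι (Q'' l), f⟫_ℂ = ⟪l, T f⟫_ℂ)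
    (G : SiteL2K ℂ 3 (periodsT3 F K) c₀ W₂ →ₗ[ℂ] SiteL2K ℂ 3 (periodsT3 F K) c₀ W₂)
    (hAG : ∀ f, covLapSite F n K c₀ U₀ (G f) + (am : ℂ) • T (ι (Q'' (G f))) = f)
    (hGA : ∀ u, G (covLapSite F n K c₀ U₀ u + (am : ℂ) • T (ι (Q'' u))) = u)
    {a' : ℝ} (ha' : 0 ≤ a')
    {κ Cpt : ℝ} (hκ : 0 < κ) (hCpt : 0 ≤ Cpt)
    (hcol : ∀ (y : Site (F.P K) (K - n)) (Y : Matrix (Fin 2) (Fin 2) ℂ) (x : Site (F.P K) 0),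
      ‖WL2.equiv ℂ _ W₂ (G (T (ι (Pi.single y Y)))) (siteEquiv F K x)‖ ≤ Cpt * Real.exp (-(κ * (Site.tdist (P := F.P K) (iterBlockOf (K - n) x) y : ℝ))) * ‖Y‖)
    {Bv : ℝ} (hGsup : ∀ (f : SiteL2K ℂ 3 (periodsT3 F K) c₀ W₂) (Fb : ℝ), (∀ y, ‖WL2.equiv ℂ _ W₂ f y‖ ≤ Fb) → ∀ y, ‖WL2.equiv ℂ _ W₂ (G f) y‖ ≤ Bv * Fb)
    {R₁ : ℝ} (hT1 : ∀ (f : SiteL2K ℂ 3 (periodsT3 F K) c₀ W₂) (Fb : ℝ), (∀ y, ‖WL2.equiv ℂ _ W₂ f y‖ ≤ Fb) →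
      ∀ p : Bond 3 (periodsT3 F K), ‖WL2.equiv ℂ _ W₂ (DL2 F n K c₀ U₀ (G f)) p‖ ≤ R₁ * Fb)
    (g : SiteL2K ℂ 3 (periodsT3 F K) c₀ W₂) (Gb : ℝ) (hg : ∀ y, ‖WL2.equiv ℂ _ W₂ g y‖ ≤ Gb) (p : Bond 3 (periodsT3 F K)) :
    ‖WL2.equiv ℂ _ W₂ (DL2 F n K c₀ U₀ (GprimeP F n K h c₀ cB a' U₀ (RS F n K h c₀ cB U₀ g))) p‖ ≤ R₁ * (1 + Bv * (10 * (18 / (2 / ((1 + 25 / 8) * (600 * (27 / 4 : ℝ) ^ 6 + am))) ^ 2) * (4 * (2 * (1 + 1 / (min ((1 / (10 * Real.sqrt (max 2 (16 / am)) * Real.sqrt (27 + 2025 / 8 * am))) / 2) ((2 / ((1 + 25 / 8) * (600 * (27 / 4 : ℝ) ^ 6 + am))) / (3 * (Real.sqrt (max 2 (16 / am)) * (2 + Real.sqrt (max 2 (16 / am))) * (3 * Real.sqrt 3 + 27 + 9 * Real.sqrt am * Real.sqrt (25 / 8) + 81 * am * (25 / 8))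
                * (8 * Real.sqrt (max 2 (16 / am)) + 8 * Real.sqrt (max 2 (16 / am)) ^ 2) * (10 * Real.sqrt (25 / 8)) + 9 * (max 2 (16 / am)) * Real.sqrt (25 / 8))))))) ^ 3) * (Cpt * (2 * (1 + 1 / κ)) ^ 3))) * Gb := by
  obtain ⟨c, hsrcid, hsrc⟩ := hsrc_pin_exists F h hε₀ hε7 U₀ hreg Q'' hseq hnK ham ι hι T hT G hAG hGA hκ hCpt hcol
  exact norm_equiv_DL2_GprimeP_RS_le_of_letters F h U₀ Q'' hseq ι T G hGA hRS hker ha' c hsrcid hsrc hGsup hT1 g Gb hg p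

include hε₀ hε7 hreg hseq hRS hker in
/-- ★ **(c4) PINNED: `‖(R_S(G′ᴾ_{a′} g))(y)‖ ≤ B_v·(1 + C_src⋆·B_v)·Gb`** ((Z0): `R_SG′ᴾ = R_SG_a = G_a(1 − TcG_a)`). [cite: Balaban1985BackgroundPropagators, (3.21)–(3.25) p.394, Thm 3.1 (3.42)∕(3.46) pp.397–398, (3.49) p.399; Balaban1985Variational, (138)–(139) p.299] -/
theorem norm_equiv_RS_GprimeP_le_pin (hnK : n < K) {am : ℝ} (ham : 0 < am) [hc₁ : Fact (0 < (c₀ * ((F.L : ℝ) ^ 3) ^ (K - n)))]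
    (ι : (Site (F.P K) (K - n) → Matrix (Fin 2) (Fin 2) ℂ) →ₗ[ℂ] SiteL2K ℂ 3 (periodsT3 F n) (c₀ * ((F.L : ℝ) ^ 3) ^ (K - n)) W₂)
    (hι : ∀ c, ι c = toL2S F n (c₀ * ((F.L : ℝ) ^ 3) ^ (K - n)) (fun z => c (siteShift (sites_eq F n K h) z)))
    (T : SiteL2K ℂ 3 (periodsT3 F n) (c₀ * ((F.L : ℝ) ^ 3) ^ (K - n)) W₂ →ₗ[ℂ] SiteL2K ℂ 3 (periodsT3 F K) c₀ W₂)
    (hT : ∀ (l : SiteL2K ℂ 3 (periodsT3 F K) c₀ W₂) (f : SiteL2K ℂ 3 (periodsT3 F n) (c₀ * ((F.L : ℝ) ^ 3) ^ (K - n)) W₂), ⟪ι (Q'' l), f⟫_ℂ = ⟪l, T f⟫_ℂ)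
    (G : SiteL2K ℂ 3 (periodsT3 F K) c₀ W₂ →ₗ[ℂ] SiteL2K ℂ 3 (periodsT3 F K) c₀ W₂)
    (hAG : ∀ f, covLapSite F n K c₀ U₀ (G f) + (am : ℂ) • T (ι (Q'' (G f))) = f)
    (hGA : ∀ u, G (covLapSite F n K c₀ U₀ u + (am : ℂ) • T (ι (Q'' u))) = u)
    {a' : ℝ} (ha' : 0 ≤ a')
    {κ Cpt : ℝ} (hκ : 0 < κ) (hCpt : 0 ≤ Cpt)
    (hcol : ∀ (y : Site (F.P K) (K - n)) (Y : Matrix (Fin 2) (Fin 2) ℂ) (x : Site (F.P K) 0),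
      ‖WL2.equiv ℂ _ W₂ (G (T (ι (Pi.single y Y)))) (siteEquiv F K x)‖ ≤ Cpt * Real.exp (-(κ * (Site.tdist (P := F.P K) (iterBlockOf (K - n) x) y : ℝ))) * ‖Y‖)
    {Bv : ℝ} (hGsup : ∀ (f : SiteL2K ℂ 3 (periodsT3 F K) c₀ W₂) (Fb : ℝ), (∀ y, ‖WL2.equiv ℂ _ W₂ f y‖ ≤ Fb) → ∀ y, ‖WL2.equiv ℂ _ W₂ (G f) y‖ ≤ Bv * Fb)
    (g : SiteL2K ℂ 3 (periodsT3 F K) c₀ W₂) (Gb : ℝ) (hg : ∀ y, ‖WL2.equiv ℂ _ W₂ g y‖ ≤ Gb) (y : TSite 3 (periodsT3 F K)) :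
    ‖WL2.equiv ℂ _ W₂ (RS F n K h c₀ cB U₀ (GprimeP F n K h c₀ cB a' U₀ g)) y‖ ≤ Bv * (1 + (10 * (18 / (2 / ((1 + 25 / 8) * (600 * (27 / 4 : ℝ) ^ 6 + am))) ^ 2) * (4 * (2 * (1 + 1 / (min ((1 / (10 * Real.sqrt (max 2 (16 / am)) * Real.sqrt (27 + 2025 / 8 * am))) / 2) ((2 / ((1 + 25 / 8) * (600 * (27 / 4 : ℝ) ^ 6 + am))) / (3 * (Real.sqrt (max 2 (16 / am)) * (2 + Real.sqrt (max 2 (16 / am))) * (3 * Real.sqrt 3 + 27 + 9 * Real.sqrt am * Real.sqrt (25 / 8) + 81 * am * (25 / 8))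
                * (8 * Real.sqrt (max 2 (16 / am)) + 8 * Real.sqrt (max 2 (16 / am)) ^ 2) * (10 * Real.sqrt (25 / 8)) + 9 * (max 2 (16 / am)) * Real.sqrt (25 / 8))))))) ^ 3) * (Cpt * (2 * (1 + 1 / κ)) ^ 3)) * Bv) * Gb := by
  obtain ⟨c, hsrcid, hsrc⟩ := hsrc_pin_exists F h hε₀ hε7 U₀ hreg Q'' hseq hnK ham ι hι T hT G hAG hGA hκ hCpt hcol
  exact norm_equiv_RS_GprimeP_le_of_letters F h U₀ Q'' hseq ι T hT G hAG hGA hRS hker ha' c hsrcid hsrc hGsup g Gb hg y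

include hε₀ hε7 hreg hseq hRS hker in
/-- ★ **(c3′) PINNED: P4's GRADIENT ROW `‖(D_{U₀}(R_S(G′ᴾ_{a′} g)))(p)‖ ≤ R₁·(1 + C_src⋆·B_v)·Gb`** (no factor 5). [cite: Balaban1985BackgroundPropagators, (3.21)–(3.25) p.394, Thm 3.1 (3.42)∕(3.46) pp.397–398, (3.49) p.399; Balaban1985Variational, (138)–(139) p.299] -/
theorem gradient_row_pin (hnK : n < K) {am : ℝ} (ham : 0 < am) [hc₁ : Fact (0 < (c₀ * ((F.L : ℝ) ^ 3) ^ (K - n)))]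
    (ι : (Site (F.P K) (K - n) → Matrix (Fin 2) (Fin 2) ℂ) →ₗ[ℂ] SiteL2K ℂ 3 (periodsT3 F n) (c₀ * ((F.L : ℝ) ^ 3) ^ (K - n)) W₂)
    (hι : ∀ c, ι c = toL2S F n (c₀ * ((F.L : ℝ) ^ 3) ^ (K - n)) (fun z => c (siteShift (sites_eq F n K h) z)))
    (T : SiteL2K ℂ 3 (periodsT3 F n) (c₀ * ((F.L : ℝ) ^ 3) ^ (K - n)) W₂ →ₗ[ℂ] SiteL2K ℂ 3 (periodsT3 F K) c₀ W₂)
    (hT : ∀ (l : SiteL2K ℂ 3 (periodsT3 F K) c₀ W₂) (f : SiteL2K ℂ 3 (periodsT3 F n) (c₀ * ((F.L : ℝ) ^ 3) ^ (K - n)) W₂), ⟪ι (Q'' l), f⟫_ℂ = ⟪l, T f⟫_ℂ)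
    (G : SiteL2K ℂ 3 (periodsT3 F K) c₀ W₂ →ₗ[ℂ] SiteL2K ℂ 3 (periodsT3 F K) c₀ W₂)
    (hAG : ∀ f, covLapSite F n K c₀ U₀ (G f) + (am : ℂ) • T (ι (Q'' (G f))) = f)
    (hGA : ∀ u, G (covLapSite F n K c₀ U₀ u + (am : ℂ) • T (ι (Q'' u))) = u)
    {a' : ℝ} (ha' : 0 ≤ a')
    {κ Cpt : ℝ} (hκ : 0 < κ) (hCpt : 0 ≤ Cpt)
    (hcol : ∀ (y : Site (F.P K) (K - n)) (Y : Matrix (Fin 2) (Fin 2) ℂ) (x : Site (F.P K) 0),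
      ‖WL2.equiv ℂ _ W₂ (G (T (ι (Pi.single y Y)))) (siteEquiv F K x)‖ ≤ Cpt * Real.exp (-(κ * (Site.tdist (P := F.P K) (iterBlockOf (K - n) x) y : ℝ))) * ‖Y‖)
    {Bv : ℝ} (hGsup : ∀ (f : SiteL2K ℂ 3 (periodsT3 F K) c₀ W₂) (Fb : ℝ), (∀ y, ‖WL2.equiv ℂ _ W₂ f y‖ ≤ Fb) → ∀ y, ‖WL2.equiv ℂ _ W₂ (G f) y‖ ≤ Bv * Fb)
    {R₁ : ℝ} (hT1 : ∀ (f : SiteL2K ℂ 3 (periodsT3 F K) c₀ W₂) (Fb : ℝ), (∀ y, ‖WL2.equiv ℂ _ W₂ f y‖ ≤ Fb) →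
      ∀ p : Bond 3 (periodsT3 F K), ‖WL2.equiv ℂ _ W₂ (DL2 F n K c₀ U₀ (G f)) p‖ ≤ R₁ * Fb)
    (g : SiteL2K ℂ 3 (periodsT3 F K) c₀ W₂) (Gb : ℝ) (hg : ∀ y, ‖WL2.equiv ℂ _ W₂ g y‖ ≤ Gb) (p : Bond 3 (periodsT3 F K)) :
    ‖WL2.equiv ℂ _ W₂ (DL2 F n K c₀ U₀ (RS F n K h c₀ cB U₀ (GprimeP F n K h c₀ cB a' U₀ g))) p‖ ≤ R₁ * (1 + (10 * (18 / (2 / ((1 + 25 / 8) * (600 * (27 / 4 : ℝ) ^ 6 + am))) ^ 2) * (4 * (2 * (1 + 1 / (min ((1 / (10 * Real.sqrt (max 2 (16 / am)) * Real.sqrt (27 + 2025 / 8 * am))) / 2) ((2 / ((1 + 25 / 8) * (600 * (27 / 4 : ℝ) ^ 6 + am))) / (3 * (Real.sqrt (max 2 (16 / am)) * (2 + Real.sqrt (max 2 (16 / am))) * (3 * Real.sqrt 3 + 27 + 9 * Real.sqrt am * Real.sqrt (25 / 8) + 81 * am * (25 / 8))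
                * (8 * Real.sqrt (max 2 (16 / am)) + 8 * Real.sqrt (max 2 (16 / am)) ^ 2) * (10 * Real.sqrt (25 / 8)) + 9 * (max 2 (16 / am)) * Real.sqrt (25 / 8))))))) ^ 3) * (Cpt * (2 * (1 + 1 / κ)) ^ 3)) * Bv) * Gb := by
  obtain ⟨c, hsrcid, hsrc⟩ := hsrc_pin_exists F h hε₀ hε7 U₀ hreg Q'' hseq hnK ham ι hι T hT G hAG hGA hκ hCpt hcol
  exact gradient_row_of_letters' F h U₀ Q'' hseq ι T hT G hAG hGA hRS hker ha' c hsrcid hsrc hGsup hT1 g Gb hg p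

include hε₀ hε7 hreg hseq hRS hker in
/-- ★★ **hPcol PINNED WITH THE IMPROVED CONSTANT `4√2·(R₁·(1 + C_src⋆·B_v))`** (PIN-A ✓`hPcol_pin` had `4√2·(R₁·(5·(1 + C_src⋆·B_v)))`; (Z0) removes the `(1 − P₀)` factor 5).
[cite: Balaban1985BackgroundPropagators, (3.21)–(3.25) p.394, Thm 3.1 (3.42)∕(3.46) pp.397–398, (3.49) p.399; Balaban1985Variational, (138)–(139) p.299] -/
theorem hPcol_pin' (hnK : n < K) {am : ℝ} (ham : 0 < am) [hc₁ : Fact (0 < (c₀ * ((F.L : ℝ) ^ 3) ^ (K - n)))]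
    (ι : (Site (F.P K) (K - n) → Matrix (Fin 2) (Fin 2) ℂ) →ₗ[ℂ] SiteL2K ℂ 3 (periodsT3 F n) (c₀ * ((F.L : ℝ) ^ 3) ^ (K - n)) W₂)
    (hι : ∀ c, ι c = toL2S F n (c₀ * ((F.L : ℝ) ^ 3) ^ (K - n)) (fun z => c (siteShift (sites_eq F n K h) z)))
    (T : SiteL2K ℂ 3 (periodsT3 F n) (c₀ * ((F.L : ℝ) ^ 3) ^ (K - n)) W₂ →ₗ[ℂ] SiteL2K ℂ 3 (periodsT3 F K) c₀ W₂)
    (hT : ∀ (l : SiteL2K ℂ 3 (periodsT3 F K) c₀ W₂) (f : SiteL2K ℂ 3 (periodsT3 F n) (c₀ * ((F.L : ℝ) ^ 3) ^ (K - n)) W₂), ⟪ι (Q'' l), f⟫_ℂ = ⟪l, T f⟫_ℂ)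
    (G : SiteL2K ℂ 3 (periodsT3 F K) c₀ W₂ →ₗ[ℂ] SiteL2K ℂ 3 (periodsT3 F K) c₀ W₂)
    (hAG : ∀ f, covLapSite F n K c₀ U₀ (G f) + (am : ℂ) • T (ι (Q'' (G f))) = f)
    (hGA : ∀ u, G (covLapSite F n K c₀ U₀ u + (am : ℂ) • T (ι (Q'' u))) = u)
    {a' : ℝ} (ha' : 0 ≤ a')
    {κ Cpt : ℝ} (hκ : 0 < κ) (hCpt : 0 ≤ Cpt)
    (hcol : ∀ (y : Site (F.P K) (K - n)) (Y : Matrix (Fin 2) (Fin 2) ℂ) (x : Site (F.P K) 0),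
      ‖WL2.equiv ℂ _ W₂ (G (T (ι (Pi.single y Y)))) (siteEquiv F K x)‖ ≤ Cpt * Real.exp (-(κ * (Site.tdist (P := F.P K) (iterBlockOf (K - n) x) y : ℝ))) * ‖Y‖)
    {Bv : ℝ} (hGsup : ∀ (f : SiteL2K ℂ 3 (periodsT3 F K) c₀ W₂) (Fb : ℝ), (∀ y, ‖WL2.equiv ℂ _ W₂ f y‖ ≤ Fb) → ∀ y, ‖WL2.equiv ℂ _ W₂ (G f) y‖ ≤ Bv * Fb)
    {R₁ : ℝ} (hT1 : ∀ (f : SiteL2K ℂ 3 (periodsT3 F K) c₀ W₂) (Fb : ℝ), (∀ y, ‖WL2.equiv ℂ _ W₂ f y‖ ≤ Fb) →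
      ∀ p : Bond 3 (periodsT3 F K), ‖WL2.equiv ℂ _ W₂ (DL2 F n K c₀ U₀ (G f)) p‖ ≤ R₁ * Fb)
    (bd : PBond (F.P K) 0) (E : Matrix (Fin 2) (Fin 2) ℂ) :
    ∑ x : Site (F.P K) 0, ‖(toL2S F K c₀).symm (GprimeP F n K h c₀ cB a' U₀ (RS F n K h c₀ cB U₀ (DstarL2 F n K c₀ U₀ (toL2 F K c₀ (Pi.single bd E))))) x‖
      ≤ 4 * Real.sqrt 2 * (R₁ * (1 + (10 * (18 / (2 / ((1 + 25 / 8) * (600 * (27 / 4 : ℝ) ^ 6 + am))) ^ 2) * (4 * (2 * (1 + 1 / (min ((1 / (10 * Real.sqrt (max 2 (16 / am)) * Real.sqrt (27 + 2025 / 8 * am))) / 2) ((2 / ((1 + 25 / 8) * (600 * (27 / 4 : ℝ) ^ 6 + am))) / (3 * (Real.sqrt (max 2 (16 / am)) * (2 + Real.sqrt (max 2 (16 / am))) * (3 * Real.sqrt 3 + 27 + 9 * Real.sqrt am * Real.sqrt (25 / 8) + 81 * am * (25 / 8))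
                * (8 * Real.sqrt (max 2 (16 / am)) + 8 * Real.sqrt (max 2 (16 / am)) ^ 2) * (10 * Real.sqrt (25 / 8)) + 9 * (max 2 (16 / am)) * Real.sqrt (25 / 8))))))) ^ 3) * (Cpt * (2 * (1 + 1 / κ)) ^ 3)) * Bv)) * ‖E‖ := by
  obtain ⟨c, hsrcid, hsrc⟩ := hsrc_pin_exists F h hε₀ hε7 U₀ hreg Q'' hseq hnK ham ι hι T hT G hAG hGA hκ hCpt hcol
  exact hPcol_of_letters' F h U₀ Q'' hseq ι T hT G hAG hGA hRS hker ha' c hsrcid hsrc hGsup hT1 bd E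

/-! ## §3 The route-currency letters (FILE C's display) at the pin -/

include hε₀ hε7 hreg hseq hRS hker in
/-- ★ **(c1ʳ) PINNED = FILE C's (c1) at the pin: `‖toL2S⁻¹(G′ᴾ_{a′}(R_S(toL2S v))) x‖ ≤ √2·B_v(1 + B_v·C_src⋆)·m`** for `‖v x‖ ≤ m`. [cite: Balaban1985BackgroundPropagators, (3.21)–(3.25) p.394, Thm 3.1 (3.42)∕(3.46) pp.397–398, (3.49) p.399; Balaban1985Variational, (138)–(139) p.299] -/
theorem norm_symm_GprimeP_RS_toL2S_le_pin (hnK : n < K) {am : ℝ} (ham : 0 < am) [hc₁ : Fact (0 < (c₀ * ((F.L : ℝ) ^ 3) ^ (K - n)))]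
    (ι : (Site (F.P K) (K - n) → Matrix (Fin 2) (Fin 2) ℂ) →ₗ[ℂ] SiteL2K ℂ 3 (periodsT3 F n) (c₀ * ((F.L : ℝ) ^ 3) ^ (K - n)) W₂)
    (hι : ∀ c, ι c = toL2S F n (c₀ * ((F.L : ℝ) ^ 3) ^ (K - n)) (fun z => c (siteShift (sites_eq F n K h) z)))
    (T : SiteL2K ℂ 3 (periodsT3 F n) (c₀ * ((F.L : ℝ) ^ 3) ^ (K - n)) W₂ →ₗ[ℂ] SiteL2K ℂ 3 (periodsT3 F K) c₀ W₂)
    (hT : ∀ (l : SiteL2K ℂ 3 (periodsT3 F K) c₀ W₂) (f : SiteL2K ℂ 3 (periodsT3 F n) (c₀ * ((F.L : ℝ) ^ 3) ^ (K - n)) W₂), ⟪ι (Q'' l), f⟫_ℂ = ⟪l, T f⟫_ℂ)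
    (G : SiteL2K ℂ 3 (periodsT3 F K) c₀ W₂ →ₗ[ℂ] SiteL2K ℂ 3 (periodsT3 F K) c₀ W₂)
    (hAG : ∀ f, covLapSite F n K c₀ U₀ (G f) + (am : ℂ) • T (ι (Q'' (G f))) = f)
    (hGA : ∀ u, G (covLapSite F n K c₀ U₀ u + (am : ℂ) • T (ι (Q'' u))) = u)
    {a' : ℝ} (ha' : 0 ≤ a')
    {κ Cpt : ℝ} (hκ : 0 < κ) (hCpt : 0 ≤ Cpt)
    (hcol : ∀ (y : Site (F.P K) (K - n)) (Y : Matrix (Fin 2) (Fin 2) ℂ) (x : Site (F.P K) 0),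
      ‖WL2.equiv ℂ _ W₂ (G (T (ι (Pi.single y Y)))) (siteEquiv F K x)‖ ≤ Cpt * Real.exp (-(κ * (Site.tdist (P := F.P K) (iterBlockOf (K - n) x) y : ℝ))) * ‖Y‖)
    {Bv : ℝ} (hGsup : ∀ (f : SiteL2K ℂ 3 (periodsT3 F K) c₀ W₂) (Fb : ℝ), (∀ y, ‖WL2.equiv ℂ _ W₂ f y‖ ≤ Fb) → ∀ y, ‖WL2.equiv ℂ _ W₂ (G f) y‖ ≤ Bv * Fb)
    (v : Site (F.P K) 0 → Matrix (Fin 2) (Fin 2) ℂ) {m : ℝ} (hv : ∀ x, ‖v x‖ ≤ m) (x : Site (F.P K) 0) :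
    ‖(toL2S F K c₀).symm (GprimeP F n K h c₀ cB a' U₀ (RS F n K h c₀ cB U₀ (toL2S F K c₀ v))) x‖ ≤ Real.sqrt 2 * (Bv * (1 + Bv * (10 * (18 / (2 / ((1 + 25 / 8) * (600 * (27 / 4 : ℝ) ^ 6 + am))) ^ 2) * (4 * (2 * (1 + 1 / (min ((1 / (10 * Real.sqrt (max 2 (16 / am)) * Real.sqrt (27 + 2025 / 8 * am))) / 2) ((2 / ((1 + 25 / 8) * (600 * (27 / 4 : ℝ) ^ 6 + am))) / (3 * (Real.sqrt (max 2 (16 / am)) * (2 + Real.sqrt (max 2 (16 / am))) * (3 * Real.sqrt 3 + 27 + 9 * Real.sqrt am * Real.sqrt (25 / 8) + 81 * am * (25 / 8))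
                * (8 * Real.sqrt (max 2 (16 / am)) + 8 * Real.sqrt (max 2 (16 / am)) ^ 2) * (10 * Real.sqrt (25 / 8)) + 9 * (max 2 (16 / am)) * Real.sqrt (25 / 8))))))) ^ 3) * (Cpt * (2 * (1 + 1 / κ)) ^ 3)))) * m := by
  obtain ⟨c, hsrcid, hsrc⟩ := hsrc_pin_exists F h hε₀ hε7 U₀ hreg Q'' hseq hnK ham ι hι T hT G hAG hGA hκ hCpt hcol
  exact norm_symm_GprimeP_RS_toL2S_le_of_letters F h U₀ Q'' hseq ι T G hGA hRS hker ha' c hsrcid hsrc hGsup v hv x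

include hε₀ hε7 hreg hseq hRS hker in
/-- ★ **(c2ʳ) PINNED = FILE C's (c2) at the pin: `‖toL2⁻¹(D_{U₀}(G′ᴾ_{a′}(R_S(toL2S v)))) b‖ ≤ √2·R₁(1 + B_v·C_src⋆)·m`** for `‖v x‖ ≤ m`. [cite: Balaban1985BackgroundPropagators, (3.21)–(3.25) p.394, Thm 3.1 (3.42)∕(3.46) pp.397–398, (3.49) p.399; Balaban1985Variational, (138)–(139) p.299] -/
theorem norm_symm_DL2_GprimeP_RS_toL2S_le_pin (hnK : n < K) {am : ℝ} (ham : 0 < am) [hc₁ : Fact (0 < (c₀ * ((F.L : ℝ) ^ 3) ^ (K - n)))]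
    (ι : (Site (F.P K) (K - n) → Matrix (Fin 2) (Fin 2) ℂ) →ₗ[ℂ] SiteL2K ℂ 3 (periodsT3 F n) (c₀ * ((F.L : ℝ) ^ 3) ^ (K - n)) W₂)
    (hι : ∀ c, ι c = toL2S F n (c₀ * ((F.L : ℝ) ^ 3) ^ (K - n)) (fun z => c (siteShift (sites_eq F n K h) z)))
    (T : SiteL2K ℂ 3 (periodsT3 F n) (c₀ * ((F.L : ℝ) ^ 3) ^ (K - n)) W₂ →ₗ[ℂ] SiteL2K ℂ 3 (periodsT3 F K) c₀ W₂)
    (hT : ∀ (l : SiteL2K ℂ 3 (periodsT3 F K) c₀ W₂) (f : SiteL2K ℂ 3 (periodsT3 F n) (c₀ * ((F.L : ℝ) ^ 3) ^ (K - n)) W₂), ⟪ι (Q'' l), f⟫_ℂ = ⟪l, T f⟫_ℂ)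
    (G : SiteL2K ℂ 3 (periodsT3 F K) c₀ W₂ →ₗ[ℂ] SiteL2K ℂ 3 (periodsT3 F K) c₀ W₂)
    (hAG : ∀ f, covLapSite F n K c₀ U₀ (G f) + (am : ℂ) • T (ι (Q'' (G f))) = f)
    (hGA : ∀ u, G (covLapSite F n K c₀ U₀ u + (am : ℂ) • T (ι (Q'' u))) = u)
    {a' : ℝ} (ha' : 0 ≤ a')
    {κ Cpt : ℝ} (hκ : 0 < κ) (hCpt : 0 ≤ Cpt)
    (hcol : ∀ (y : Site (F.P K) (K - n)) (Y : Matrix (Fin 2) (Fin 2) ℂ) (x : Site (F.P K) 0),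
      ‖WL2.equiv ℂ _ W₂ (G (T (ι (Pi.single y Y)))) (siteEquiv F K x)‖ ≤ Cpt * Real.exp (-(κ * (Site.tdist (P := F.P K) (iterBlockOf (K - n) x) y : ℝ))) * ‖Y‖)
    {Bv : ℝ} (hGsup : ∀ (f : SiteL2K ℂ 3 (periodsT3 F K) c₀ W₂) (Fb : ℝ), (∀ y, ‖WL2.equiv ℂ _ W₂ f y‖ ≤ Fb) → ∀ y, ‖WL2.equiv ℂ _ W₂ (G f) y‖ ≤ Bv * Fb)
    {R₁ : ℝ} (hT1 : ∀ (f : SiteL2K ℂ 3 (periodsT3 F K) c₀ W₂) (Fb : ℝ), (∀ y, ‖WL2.equiv ℂ _ W₂ f y‖ ≤ Fb) →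
      ∀ p : Bond 3 (periodsT3 F K), ‖WL2.equiv ℂ _ W₂ (DL2 F n K c₀ U₀ (G f)) p‖ ≤ R₁ * Fb)
    (v : Site (F.P K) 0 → Matrix (Fin 2) (Fin 2) ℂ) {m : ℝ} (hv : ∀ x, ‖v x‖ ≤ m) (b : PBond (F.P K) 0) :
    ‖(toL2 F K c₀).symm (DL2 F n K c₀ U₀ (GprimeP F n K h c₀ cB a' U₀ (RS F n K h c₀ cB U₀ (toL2S F K c₀ v)))) b‖ ≤ Real.sqrt 2 * (R₁ * (1 + Bv * (10 * (18 / (2 / ((1 + 25 / 8) * (600 * (27 / 4 : ℝ) ^ 6 + am))) ^ 2) * (4 * (2 * (1 + 1 / (min ((1 / (10 * Real.sqrt (max 2 (16 / am)) * Real.sqrt (27 + 2025 / 8 * am))) / 2) ((2 / ((1 + 25 / 8) * (600 * (27 / 4 : ℝ) ^ 6 + am))) / (3 * (Real.sqrt (max 2 (16 / am)) * (2 + Real.sqrt (max 2 (16 / am))) * (3 * Real.sqrt 3 + 27 + 9 * Real.sqrt am * Real.sqrt (25 / 8) + 81 * am * (25 / 8))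
                * (8 * Real.sqrt (max 2 (16 / am)) + 8 * Real.sqrt (max 2 (16 / am)) ^ 2) * (10 * Real.sqrt (25 / 8)) + 9 * (max 2 (16 / am)) * Real.sqrt (25 / 8))))))) ^ 3) * (Cpt * (2 * (1 + 1 / κ)) ^ 3)))) * m := by
  obtain ⟨c, hsrcid, hsrc⟩ := hsrc_pin_exists F h hε₀ hε7 U₀ hreg Q'' hseq hnK ham ι hι T hT G hAG hGA hκ hCpt hcol
  exact norm_symm_DL2_GprimeP_RS_toL2S_le_of_letters F h U₀ Q'' hseq ι T G hGA hRS hker ha' c hsrcid hsrc hGsup hT1 v hv b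

include hε₀ hε7 hreg hseq hRS hker in
/-- ★ **(c3ʳ) PINNED = FILE C's (c3) at the pin: `‖toL2S⁻¹(R_S(G′ᴾ_{a′}(toL2S v))) x‖ ≤ √2·B_v(1 + C_src⋆·B_v)·m`** for `‖v x‖ ≤ m`. [cite: Balaban1985BackgroundPropagators, (3.21)–(3.25) p.394, Thm 3.1 (3.42)∕(3.46) pp.397–398, (3.49) p.399; Balaban1985Variational, (138)–(139) p.299] -/
theorem norm_symm_RS_GprimeP_toL2S_le_pin (hnK : n < K) {am : ℝ} (ham : 0 < am) [hc₁ : Fact (0 < (c₀ * ((F.L : ℝ) ^ 3) ^ (K - n)))]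
    (ι : (Site (F.P K) (K - n) → Matrix (Fin 2) (Fin 2) ℂ) →ₗ[ℂ] SiteL2K ℂ 3 (periodsT3 F n) (c₀ * ((F.L : ℝ) ^ 3) ^ (K - n)) W₂)
    (hι : ∀ c, ι c = toL2S F n (c₀ * ((F.L : ℝ) ^ 3) ^ (K - n)) (fun z => c (siteShift (sites_eq F n K h) z)))
    (T : SiteL2K ℂ 3 (periodsT3 F n) (c₀ * ((F.L : ℝ) ^ 3) ^ (K - n)) W₂ →ₗ[ℂ] SiteL2K ℂ 3 (periodsT3 F K) c₀ W₂)
    (hT : ∀ (l : SiteL2K ℂ 3 (periodsT3 F K) c₀ W₂) (f : SiteL2K ℂ 3 (periodsT3 F n) (c₀ * ((F.L : ℝ) ^ 3) ^ (K - n)) W₂), ⟪ι (Q'' l), f⟫_ℂ = ⟪l, T f⟫_ℂ)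
    (G : SiteL2K ℂ 3 (periodsT3 F K) c₀ W₂ →ₗ[ℂ] SiteL2K ℂ 3 (periodsT3 F K) c₀ W₂)
    (hAG : ∀ f, covLapSite F n K c₀ U₀ (G f) + (am : ℂ) • T (ι (Q'' (G f))) = f)
    (hGA : ∀ u, G (covLapSite F n K c₀ U₀ u + (am : ℂ) • T (ι (Q'' u))) = u)
    {a' : ℝ} (ha' : 0 ≤ a')
    {κ Cpt : ℝ} (hκ : 0 < κ) (hCpt : 0 ≤ Cpt)
    (hcol : ∀ (y : Site (F.P K) (K - n)) (Y : Matrix (Fin 2) (Fin 2) ℂ) (x : Site (F.P K) 0),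
      ‖WL2.equiv ℂ _ W₂ (G (T (ι (Pi.single y Y)))) (siteEquiv F K x)‖ ≤ Cpt * Real.exp (-(κ * (Site.tdist (P := F.P K) (iterBlockOf (K - n) x) y : ℝ))) * ‖Y‖)
    {Bv : ℝ} (hGsup : ∀ (f : SiteL2K ℂ 3 (periodsT3 F K) c₀ W₂) (Fb : ℝ), (∀ y, ‖WL2.equiv ℂ _ W₂ f y‖ ≤ Fb) → ∀ y, ‖WL2.equiv ℂ _ W₂ (G f) y‖ ≤ Bv * Fb)
    (v : Site (F.P K) 0 → Matrix (Fin 2) (Fin 2) ℂ) {m : ℝ} (hv : ∀ x, ‖v x‖ ≤ m) (x : Site (F.P K) 0) :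
    ‖(toL2S F K c₀).symm (RS F n K h c₀ cB U₀ (GprimeP F n K h c₀ cB a' U₀ (toL2S F K c₀ v))) x‖ ≤ Real.sqrt 2 * (Bv * (1 + (10 * (18 / (2 / ((1 + 25 / 8) * (600 * (27 / 4 : ℝ) ^ 6 + am))) ^ 2) * (4 * (2 * (1 + 1 / (min ((1 / (10 * Real.sqrt (max 2 (16 / am)) * Real.sqrt (27 + 2025 / 8 * am))) / 2) ((2 / ((1 + 25 / 8) * (600 * (27 / 4 : ℝ) ^ 6 + am))) / (3 * (Real.sqrt (max 2 (16 / am)) * (2 + Real.sqrt (max 2 (16 / am))) * (3 * Real.sqrt 3 + 27 + 9 * Real.sqrt am * Real.sqrt (25 / 8) + 81 * am * (25 / 8))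
                * (8 * Real.sqrt (max 2 (16 / am)) + 8 * Real.sqrt (max 2 (16 / am)) ^ 2) * (10 * Real.sqrt (25 / 8)) + 9 * (max 2 (16 / am)) * Real.sqrt (25 / 8))))))) ^ 3) * (Cpt * (2 * (1 + 1 / κ)) ^ 3)) * Bv)) * m := by
  obtain ⟨c, hsrcid, hsrc⟩ := hsrc_pin_exists F h hε₀ hε7 U₀ hreg Q'' hseq hnK ham ι hι T hT G hAG hGA hκ hCpt hcol
  exact norm_symm_RS_GprimeP_toL2S_le_of_letters F h U₀ Q'' hseq ι T hT G hAG hGA hRS hker ha' c hsrcid hsrc hGsup v hv x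

end Summit.QuantumFields.YangMills.Theorems.Prop7GaugeProjectorSupPackagePin

end
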